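import Summits.QuantumFields.YangMills.Theorems.FlatTubeReductionSlowReferenceTail
import HarnessLib

/-!
# The FIBRE tails of the diagonal density AT A SLOW DATUM `w`, crude form: `∫_{v ∈ R₁, v′ ∈ R₂} fpTriple(w,w)/K(w,w) dμP ≤ e^{β·E(τ,σ)}·(∫_{R₁}Ω)·(∫_{R₂}Ω)`
# (route `FlatTubeReduction`, crux K1 `NearFlatRatioLaw` stmt-QuantumFields-24720; seat `ym-line-ftr-p1` g13; rate twin «ratepack-v3 / frozen fibres»; R2b1 RECORD rung — no summit
# statement is proved here)

WHY (memo `Cruxes/NearFlatRatioLaw/Lines/ratepack-v3-frozen-g12.md` §6 (F7)).  The `htailu` hypothesis of the core+tail sandwich needs the mass of `ρ_w = fpTriple(w,w)/K(w,w)` off the core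
`{βkin ≤ T} ∩ {β‖v̂‖² ≤ T} ∩ {β‖v̂′‖² ≤ T}`; `…SlowReferenceTail.slow_reference_tail_abs_le` handles the kinetic part.  For the two FIBRE parts no gauge Gaussian is needed: with
`…ReferenceDensityDomination.fpTriple_diag_div_le` (`ρ_w ≤ Ω(v̂)·fpWeight(g)·Ω(v̂′)·e^{−βkin_w + βE(τ,σ)}`), `fpWeight ≤ 1`, `e^{−βkin} ≤ 1` and the product structure of `μP`, the mass on
`{v ∈ R₁} ∩ {v′ ∈ R₂}` is at most `e^{βE}·(∫_{R₁}Ω)(∫_{R₂}Ω)`.  Against the floor `f(1) ≥ c₁·fpZ ε·(β^{-3/2}/10)^n·θ²` this loses only the polynomial `fpZ⁻¹β^{3n/2}`, which the Gaussian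
PROFILE tail `∫_{β‖v̂‖²>T}Ω ≤ e^{−cT}·I₀` absorbs (`T = β^{1/8}`).
  ★★ `slow_mass_on_fibreSets_le`.
HONEST FRAMING: Fubini bookkeeping; femto rung R2b1 (RECORD label); not infinite volume, not a gap, not Clay.  No defs, no named facts, no `sorry`.
-/

set_option autoImplicit false

noncomputable section

open MeasureTheory Filter Topology Real Set
open scoped BigOperators ENNReal
open Literature.MathematicalPhysics.QuantumFieldTheory
open Literature.MathematicalPhysics.QuantumLattice

namespace Summit.QuantumFields.YangMills.Theorems.FemtoTransferGap.RateTube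

open Summit.QuantumFields.YangMills.Theorems.FemtoTransferGap
open Summit.QuantumFields.YangMills.Theorems.FemtoTransferGap.TwoLattice
open Summit.QuantumFields.YangMills.Theorems.FemtoTransferGap.TwoLattice.ConstTube
open Summit.QuantumFields.YangMills.Theorems.FemtoTransferGap.TwoLattice.Avg
open Summit.QuantumFields.YangMills.Theorems.FemtoTransferGap.TwoLattice.Cov
open Summit.QuantumFields.YangMills.Theorems.FemtoTransferGap.TwoLattice.Stiff (LinkSpace)

variable {L : ℕ} [NeZero L]

set_option maxHeartbeats 800000 in
/-- ★★ **Fibre-set mass of the diagonal density at a slow datum, crude form.**  `β ≥ 0`; slow datum `w` with `L³S₁(w) ≤ σ < 2`; profile `Ω` (measurable, `0 ≤ Ω ≤ CΩ`) supported on the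
cap with components `|v_{e,c}| ≤ τ ≤ 1/30`; measurable fibre sets `R₁, R₂`.  Then
`∫_{v ∈ R₁, v′ ∈ R₂} fpTriple β Ω (fpWeight ε) w w dμP / K(w,w) ≤ e^{β·stepActionErr τ σ}·(∫_{R₁}Ω dπ)·(∫_{R₂}Ω dπ)`. [cite: Luscher1983, §3] -/
theorem slow_mass_on_fibreSets_le {β : ℝ} (hβ : 0 ≤ β) (w : GaugeConfig 3 1 SU2) {σ : ℝ} (hσ : σ < 2) (hS : (L : ℝ) ^ 3 * wilsonAction su2Rep w ≤ σ)
    {Ω : LinkSpace L → ℝ} (hΩm : Measurable Ω) {CΩ : ℝ} (hCΩ : ∀ x, |Ω x| ≤ CΩ) (hΩ0 : ∀ x, 0 ≤ Ω x) {τ : ℝ} (hτ : τ ≤ 1 / 30)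
    (hΩc : ∀ v : Edge 3 L → Fin 3 → ℝ, Ω (linkEmbed L v) ≠ 0 → v ∈ capBalancedSet L)
    (hΩτ : ∀ v : Edge 3 L → Fin 3 → ℝ, Ω (linkEmbed L v) ≠ 0 → ∀ (e : Edge 3 L) (c : Fin 3), |v e c| ≤ τ) (ε : ℝ)
    {R₁ R₂ : Set (Edge 3 L → Fin 3 → ℝ)} (hR₁ : MeasurableSet R₁) (hR₂ : MeasurableSet R₂) :
    (∫ p in {p : (Edge 3 L → Fin 3 → ℝ) × ((Edge 3 L → Fin 3 → ℝ) × (Site 3 L → SU2)) | p.1 ∈ R₁ ∧ p.2.1 ∈ R₂},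
        fpTriple L β Ω (fpWeight L ε) w w p ∂((orthoTransverse L).prod ((orthoTransverse L).prod (gaugeMeasure L)))) / transferKernel su2Rep ((L : ℝ) ^ 3 * β) w w ≤
      Real.exp (β * stepActionErr (L := L) τ σ) * ((∫ v in R₁, Ω (linkEmbed L v) ∂orthoTransverse L) * (∫ v in R₂, Ω (linkEmbed L v) ∂orthoTransverse L)) := by
  haveI := isFiniteMeasure_orthoTransverse L
  haveI : SecondCountableTopology SU2 := secondCountableTopology_su2
  haveI : IsProbabilityMeasure (gaugeMeasure L) := by unfold gaugeMeasure; infer_instance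
  set π' := orthoTransverse L with hπ
  set μP : Measure ((Edge 3 L → Fin 3 → ℝ) × ((Edge 3 L → Fin 3 → ℝ) × (Site 3 L → SU2))) := π'.prod (π'.prod (gaugeMeasure L)) with hμP
  haveI : IsFiniteMeasure μP := by rw [hμP]; infer_instance
  set Kw : ℝ := transferKernel su2Rep ((L : ℝ) ^ 3 * β) w w with hKw
  have hKwp : 0 < Kw := transferKernel_pos _ _ _ _
  have hle : Measurable (linkEmbed L) := measurable_linkEmbed L
  have hfw : Measurable (fpWeight L ε) := measurable_fpWeight L ε
  have hCΩ0 : 0 ≤ CΩ := (abs_nonneg _).trans (hCΩ 0)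
  set E : ℝ := Real.exp (β * stepActionErr (L := L) τ σ) with hE
  have hE0 : 0 ≤ E := (Real.exp_pos _).le
  -- the two truncated profiles
  set G₁ : (Edge 3 L → Fin 3 → ℝ) → ℝ := fun v => R₁.indicator (fun v => Ω (linkEmbed L v)) v with hG₁
  set G₂ : (Edge 3 L → Fin 3 → ℝ) → ℝ := fun v => R₂.indicator (fun v => Ω (linkEmbed L v)) v with hG₂
  have hG₁m : Measurable G₁ := (hΩm.comp hle).indicator hR₁
  have hG₂m : Measurable G₂ := (hΩm.comp hle).indicator hR₂
  have hG₁0 : ∀ v, 0 ≤ G₁ v := fun v => Set.indicator_nonneg (fun w _ => hΩ0 _) _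
  have hG₂0 : ∀ v, 0 ≤ G₂ v := fun v => Set.indicator_nonneg (fun w _ => hΩ0 _) _
  have hG₁le : ∀ v, G₁ v ≤ Ω (linkEmbed L v) := fun v => Set.indicator_le_self' (fun w _ => hΩ0 _) v
  have hG₂le : ∀ v, G₂ v ≤ Ω (linkEmbed L v) := fun v => Set.indicator_le_self' (fun w _ => hΩ0 _) v
  have hG₁b : ∀ v, |G₁ v| ≤ CΩ := fun v => by rw [abs_of_nonneg (hG₁0 v)]; exact (hG₁le v).trans ((le_abs_self _).trans (hCΩ _))
  have hG₂b : ∀ v, |G₂ v| ≤ CΩ := fun v => by rw [abs_of_nonneg (hG₂0 v)]; exact (hG₂le v).trans ((le_abs_self _).trans (hCΩ _))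
  have hG₁i : Integrable G₁ π' := integrable_of_measurable_abs_le _ hG₁m hG₁b
  have hG₂i : Integrable G₂ π' := integrable_of_measurable_abs_le _ hG₂m hG₂b
  -- dominating product function
  set Φ : (Edge 3 L → Fin 3 → ℝ) × ((Edge 3 L → Fin 3 → ℝ) × (Site 3 L → SU2)) → ℝ := fun p => G₁ p.1 * (G₂ p.2.1 * (1 : ℝ)) with hΦ
  set Rp : Set ((Edge 3 L → Fin 3 → ℝ) × ((Edge 3 L → Fin 3 → ℝ) × (Site 3 L → SU2))) := {p | p.1 ∈ R₁ ∧ p.2.1 ∈ R₂} with hRp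
  have hRpm : MeasurableSet Rp := (measurable_fst hR₁).inter ((measurable_fst.comp measurable_snd) hR₂)
  have hdom : ∀ p, Rp.indicator (fun p => fpTriple L β Ω (fpWeight L ε) w w p / Kw) p ≤ E * Φ p := by
    intro p
    have hΦ0 : 0 ≤ Φ p := by rw [hΦ]; exact mul_nonneg (hG₁0 _) (mul_nonneg (hG₂0 _) zero_le_one)
    by_cases hp : p ∈ Rp
    · rw [Set.indicator_of_mem hp]
      obtain ⟨h1, h2⟩ := hp
      rw [hΦ]; dsimp only
      rw [hG₁, hG₂]; dsimp only; rw [Set.indicator_of_mem h1, Set.indicator_of_mem h2, mul_one]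
      by_cases hz : Ω (linkEmbed L p.1) * Ω (linkEmbed L p.2.1) = 0
      · have hnum : fpTriple L β Ω (fpWeight L ε) w w p = 0 := by
          unfold fpTriple
          rcases mul_eq_zero.mp hz with h | h
          · rw [h, zero_mul]
          · rw [h, mul_zero, mul_zero]
        rw [hnum, zero_div]; exact mul_nonneg hE0 (mul_nonneg (hΩ0 _) (hΩ0 _))
      · have hv : Ω (linkEmbed L p.1) ≠ 0 := fun h => hz (by rw [h, zero_mul])
        have hv' : Ω (linkEmbed L p.2.1) ≠ 0 := fun h => hz (by rw [h, mul_zero])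
        have h := fpTriple_diag_div_le (L := L) hβ hΩ0 (fun g => (fpWeight_mem_Icc L ε g).1) w (hΩc _ hv) (hΩc _ hv') hτ hσ hS (hΩτ _ hv) (hΩτ _ hv') p.2.2
        have hp' : p = (p.1, (p.2.1, p.2.2)) := rfl
        rw [hp'] at h ⊢
        refine h.trans ?_
        have hexp : Real.exp (-(β * kinDefect L (orthoTube L w p.1) (orthoTube L w p.2.1) p.2.2) + β * stepActionErr (L := L) τ σ) ≤ E := by
          rw [hE]; refine Real.exp_le_exp.mpr ?_
          nlinarith [kinDefect_nonneg (orthoTube L w p.1) (orthoTube L w p.2.1) p.2.2, hβ]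
        have hW1 := (fpWeight_mem_Icc L ε p.2.2).2
        have hW0 := (fpWeight_mem_Icc L ε p.2.2).1
        calc Ω (linkEmbed L p.1) * (fpWeight L ε p.2.2 * Ω (linkEmbed L p.2.1)) * Real.exp (-(β * kinDefect L (orthoTube L w p.1) (orthoTube L w p.2.1) p.2.2) + β * stepActionErr (L := L) τ σ)
            ≤ Ω (linkEmbed L p.1) * (1 * Ω (linkEmbed L p.2.1)) * E :=
              mul_le_mul (mul_le_mul_of_nonneg_left (mul_le_mul_of_nonneg_right hW1 (hΩ0 _)) (hΩ0 _)) hexp (Real.exp_pos _).le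
                (mul_nonneg (hΩ0 _) (mul_nonneg zero_le_one (hΩ0 _)))
          _ = E * (Ω (linkEmbed L p.1) * Ω (linkEmbed L p.2.1)) := by ring
    · rw [Set.indicator_of_notMem hp]; exact mul_nonneg hE0 hΦ0
  -- integrability
  obtain ⟨Bρ, hBρ⟩ := abs_fpTriple_le (L := L) β hCΩ (CW := 1) (fun g => by rw [abs_of_nonneg (fpWeight_mem_Icc L ε g).1]; exact (fpWeight_mem_Icc L ε g).2) w w
  have hρm : Measurable fun p => fpTriple L β Ω (fpWeight L ε) w w p / Kw := (measurable_fpTriple β hΩm hfw w w).div_const _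
  have hρi : Integrable (fun p => fpTriple L β Ω (fpWeight L ε) w w p / Kw) μP :=
    integrable_of_measurable_abs_le _ hρm (C := Bρ / Kw) fun p => by rw [abs_div, abs_of_pos hKwp]; exact div_le_div_of_nonneg_right (hBρ p) hKwp.le
  have hΦi : Integrable Φ μP := by
    rw [hΦ, hμP]
    exact hG₁i.mul_prod (hG₂i.mul_prod (integrable_const (1 : ℝ)))
  -- integrate
  have h1 : (∫ p in Rp, fpTriple L β Ω (fpWeight L ε) w w p ∂μP) / Kw = ∫ p, Rp.indicator (fun p => fpTriple L β Ω (fpWeight L ε) w w p / Kw) p ∂μP := by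
    rw [integral_indicator hRpm, integral_div]
  have h2 : ∫ p, Rp.indicator (fun p => fpTriple L β Ω (fpWeight L ε) w w p / Kw) p ∂μP ≤ ∫ p, E * Φ p ∂μP :=
    integral_mono (hρi.indicator hRpm) (hΦi.const_mul E) hdom
  have i2 : ∫ q, G₂ q.1 * (1 : ℝ) ∂(π'.prod (gaugeMeasure L)) = (∫ v, G₂ v ∂π') * ∫ _g, (1 : ℝ) ∂gaugeMeasure L :=
    integral_prod_mul (f := G₂) (g := fun _ : Site 3 L → SU2 => (1 : ℝ))
  have i1 : ∫ p, Φ p ∂μP = (∫ v, G₁ v ∂π') * ∫ q, G₂ q.1 * (1 : ℝ) ∂(π'.prod (gaugeMeasure L)) := by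
    rw [hμP, hΦ]
    exact integral_prod_mul (f := G₁) (g := fun q : (Edge 3 L → Fin 3 → ℝ) × (Site 3 L → SU2) => G₂ q.1 * (1 : ℝ))
  have h3 : ∫ p, E * Φ p ∂μP = E * ((∫ v, G₁ v ∂π') * (∫ v, G₂ v ∂π')) := by
    rw [integral_const_mul, i1, i2, integral_const]
    simp
  have hG₁int : ∫ v, G₁ v ∂π' = ∫ v in R₁, Ω (linkEmbed L v) ∂π' := by rw [hG₁, integral_indicator hR₁]
  have hG₂int : ∫ v, G₂ v ∂π' = ∫ v in R₂, Ω (linkEmbed L v) ∂π' := by rw [hG₂, integral_indicator hR₂]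
  rw [h1]
  calc ∫ p, Rp.indicator (fun p => fpTriple L β Ω (fpWeight L ε) w w p / Kw) p ∂μP ≤ ∫ p, E * Φ p ∂μP := h2
    _ = E * ((∫ v in R₁, Ω (linkEmbed L v) ∂π') * (∫ v in R₂, Ω (linkEmbed L v) ∂π')) := by rw [h3, hG₁int, hG₂int]

end Summit.QuantumFields.YangMills.Theorems.FemtoTransferGap.RateTube

end
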